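import Literature.MathematicalPhysics.QuantumLattice.HubbardLSMFilling
import Literature.MathematicalPhysics.QuantumLattice.FermionRelabelling
import Literature.MathematicalPhysics.QuantumLattice.HubbardGaugeBound
import Literature.MathematicalPhysics.QuantumLattice.FinDimSpectrumSpectralGapProofs
import Literature.MathematicalPhysics.QuantumLattice.HubbardModelGrandCanonicalProofs
import HarnessLib

/-!
# The Lieb–Schultz–Mattis twist for the Hubbard model on tori: the `d = 1` case of the
# BBDF filling constraint, proved

Trunk T-QLATTICE, family `hubbard`. Sibling PROOF file of
`Literature/MathematicalPhysics/QuantumLattice/HubbardLSMFilling.lean`, whose named fact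
`bbdf2019_lsm_filling_hubbardTorus` (Bachmann–Bols–De Roeck–Fraas, CMP 375 (2019) 1249, Thm. 2.1
with Prop. 2.4 and §3.2) asserts, for every `d ≥ 1`, that the spin-resolved fillings per
transverse layer `N_σ / L` of a unique, uniformly gapped ground state of `H(t,U) - μN` on `ℤ_L^d`
are `O(L^{-∞})`-close to integers. The general-`d` statement is BBDF's many-body index theorem
(Lieb–Robinson bounds, exponential clustering, quasi-adiabatic flux insertion) and stays a named
fact. This file PROVES, from the concrete Jordan–Wigner matrices of the tree:

* the **`d = 1` case** in exactly the format of the fact (`lsm_filling_hubbardTorus_dim_one`), by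
  the elementary Lieb–Schultz–Mattis / Yamanaka–Oshikawa–Affleck "global twist" argument
  (Tasaki, J. Stat. Phys. 170 (2018) 653, §2.2 Theorem 0 and §4.2; Lieb–Schultz–Mattis 1961,
  App. B), which in one dimension gives the sharper EXACT dichotomy: `L ∣ N_σ` or
  `L ≤ 8π²|t|/g`;
* for **every `d`**, the variational Lieb–Schultz–Mattis bound
  `hubbardTorusWith_gap_le_of_not_dvd`: a unique ground state with gap `g` and `L ∤ N_σ` forces
  `g ≤ 8π² d |t| L^{d-2}` (the twist costs `O(L^{d-2})` energy — the classical reason why the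
  variational argument does not reach `d ≥ 2`, where BBDF's theorem is needed), and the
  dichotomy `hubbardTorusWith_dvd_spinCount_or_gap_le`.

## Architecture (following Tasaki 2018, §2.2 Thm. 0 / LSM 1961 App. B, for `H(t,U) - μN` on the
## full Fock space of the torus)

1. *Spectral input* (`namespace Matrix`): under `HasSpectralGap` the ground space is a line, so a
   ground state is an eigenvector of every commuting operator (`exists_mulVec_eq_smul`), and a
   vector orthogonal to it has energy `≥ E₀ + Δ` (`le_rayleigh_of_orthogonal`, eigenbasis
   expansion); the abstract twist bound `gap_le_of_twist`: if `V` is unitary, `V^{±1}ψ ⊥ ψ` and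
   `Vᴴ A V + V A Vᴴ = 2A + 2P` with `re ⟨φ, Pφ⟩ ≤ B ⟨φ, φ⟩`, then `Δ ≤ B`.
2. *Fock-space operators*: the unitary phase twist `fockTwist θ = diag(e^{iΣ_{k∈s}θ_k})`
   (`U c_j U⁻¹ = e^{-iθ_j} c_j`, number operators invariant — the unitary analogue of
   `HubbardGaugeBound.gaugeMatrix`), and the signed permutation unitary `relabelOp e`
   implementing `FermionRelabelling.relabel` (`relabel e a = Γ a Γᴴ`), so that translation
   invariance (`relabel_addRight_hubbardTorusWith`) becomes `Γ H = H Γ`.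
3. *Twisted Hamiltonian*: `U H U⁻¹ + U⁻¹ H U = 2H + 2P_θ`, `P_θ = -t T(cos(θ_u - θ_v) - 1)`
   (`fockTwist_conj_hamiltonianWith_add`), `‖P_θ‖ ≤ |t| Σ_{u∼v,σ} |cos(θ_{uσ} - θ_{vσ}) - 1|`.
4. *Torus*: for the LSM angles `θ(x,σ') = [σ' = σ] 2π x_{i₀}/L` and the unit translation in
   direction `i₀`, `Θ(s + e_{i₀}) = Θ(s) + 2π N_σ(s)/L - 2πQ` (`sum_lsmTwist_finsetCongr_lsmShift`),
   hence `U Γ ψ = e^{2πi N_σ/L} Γ U ψ` on a sector and `⟨ψ, U^{±1}ψ⟩ = 0` when `L ∤ N_σ`; adjacent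
   sites differ by `0, ±1 (mod L)` in the coordinate `i₀`, each site has `≤ 2d` neighbours, and
   `1 - cos(2π/L) ≤ 2π²/L²`, giving `re⟨φ, P_θ φ⟩ ≤ 8π² d |t| L^{d-2} ⟨φ, φ⟩`.
5. *Sectors*: on the support of a vector of `szSector N M`, `N_↑ = N/2 + M`, `N_↓ = N/2 - M`
   (`spinCount_eq_of_mem_szSector`).

Design note: all interface lemmas between the generic Fock-space sections (where `DecidableEq`
comes from the linear order) and the concrete torus (where Lean synthesises the computable
`instDecidableEqLex`) are phrased instance-free (`∀ v, Tᴴ (T v) = v`, form bounds instead of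
operator norms), because the two `DecidableEq (Orb (FermionTorus d L))` instances are not
definitionally equal (`Pi.Lex`'s linear order is classical).

## References

* H. Tasaki, *Lieb–Schultz–Mattis theorem with a local twist for general one-dimensional quantum
  systems*, J. Stat. Phys. 170 (2018) 653–671, arXiv:1708.05186: §2.2 Theorem 0
  (Yamanaka–Oshikawa–Affleck, Koma: global twist `Û_L`, `⟨Û_L† H Û_L⟩ - E_GS ≤ C/L`,
  `⟨Φ_GS, Û_L Φ_GS⟩ = 0` for non-integral filling), §4.2 (lattice electron systems, "the model
  becomes the Hubbard model"). [Tasaki2018]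
* E. Lieb, T. Schultz, D. Mattis, Ann. Phys. 16 (1961) 407–466, Appendix B, Theorem 2.
  [LiebSchultzMattisAP1961]
* M. Yamanaka, M. Oshikawa, I. Affleck, PRL 79 (1997) 1110 (twist for electrons; cited via
  Tasaki 2018, Theorem 0).
* S. Bachmann, A. Bols, W. De Roeck, M. Fraas, CMP 375 (2019) 1249, §3.2 (the general-`d`
  statement, NOT proved here). [BachmannEtAl2019]
* T. Koma, H. Tasaki, PRL 68 (1992) 3248, eqs. (5)–(9) (gauge transformation of the Hubbard
  Hamiltonian; `HubbardGaugeBound`). [KomaTasakiPRL1992]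
-/

noncomputable section

open scoped Matrix.Norms.L2Operator ComplexOrder InnerProductSpace

/-! ### Spectral lemmas: the second variational principle under a spectral gap -/

namespace Matrix

open Literature.MathematicalPhysics.QuantumLattice

variable {n : Type*} [Fintype n] [DecidableEq n]

/-- `⟨ψ, A φ⟩ = ⟪ψ, A φ⟫` in `ℓ²(n)`: the dot-product form is the Euclidean inner product. [folklore] -/
theorem star_dotProduct_mulVec_eq_inner (A : Matrix n n ℂ) (ψ φ : n → ℂ) :
    star ψ ⬝ᵥ A *ᵥ φ =
      ⟪(WithLp.toLp 2 ψ : EuclideanSpace ℂ n), toEuclideanCLM (n := n) (𝕜 := ℂ) A (WithLp.toLp 2 φ)⟫_ℂ := by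
  rw [toEuclideanCLM_toLp, EuclideanSpace.inner_eq_star_dotProduct, dotProduct_comm]

omit [DecidableEq n] in
/-- `⟨ψ, ψ⟩ = ‖ψ‖²` in `ℓ²(n)`. [folklore] -/
theorem star_dotProduct_self_eq_norm_sq (ψ : n → ℂ) :
    star ψ ⬝ᵥ ψ = ((‖(WithLp.toLp 2 ψ : EuclideanSpace ℂ n)‖ : ℝ) : ℂ) ^ 2 := by
  have h := inner_self_eq_norm_sq_to_K (𝕜 := ℂ) (WithLp.toLp 2 ψ : EuclideanSpace ℂ n)
  rw [EuclideanSpace.inner_eq_star_dotProduct, dotProduct_comm] at h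
  exact h

omit [DecidableEq n] in
/-- `re ⟨ψ, ψ⟩ = ‖ψ‖²`. [folklore] -/
theorem star_dotProduct_self_re (ψ : n → ℂ) :
    (star ψ ⬝ᵥ ψ).re = ‖(WithLp.toLp 2 ψ : EuclideanSpace ℂ n)‖ ^ 2 := by
  rw [star_dotProduct_self_eq_norm_sq, ← Complex.ofReal_pow, Complex.ofReal_re]

/-- **Rayleigh quotients are bounded by the operator norm**: `|re ⟨ψ, P ψ⟩| ≤ ‖P‖ ⟨ψ, ψ⟩`
(`ℓ²` operator norm). [folklore] -/
theorem abs_re_star_dotProduct_mulVec_le (P : Matrix n n ℂ) (ψ : n → ℂ) :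
    |(star ψ ⬝ᵥ P *ᵥ ψ).re| ≤ ‖P‖ * (star ψ ⬝ᵥ ψ).re := by
  rw [star_dotProduct_mulVec_eq_inner, star_dotProduct_self_re]
  set x : EuclideanSpace ℂ n := WithLp.toLp 2 ψ
  calc |(⟪x, toEuclideanCLM (n := n) (𝕜 := ℂ) P x⟫_ℂ).re|
      ≤ ‖⟪x, toEuclideanCLM (n := n) (𝕜 := ℂ) P x⟫_ℂ‖ := Complex.abs_re_le_norm _
    _ ≤ ‖x‖ * ‖toEuclideanCLM (n := n) (𝕜 := ℂ) P x‖ := norm_inner_le_norm _ _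
    _ ≤ ‖x‖ * (‖toEuclideanCLM (n := n) (𝕜 := ℂ) P‖ * ‖x‖) :=
        mul_le_mul_of_nonneg_left (ContinuousLinearMap.le_opNorm _ _) (norm_nonneg _)
    _ = ‖P‖ * ‖x‖ ^ 2 := by rw [cstar_norm_def]; ring

/-- **A unique ground state is an eigenvector of every symmetry.** If `A` has a simple ground
energy (`HasSpectralGap`) and `U` commutes with `A`, every ground-state vector `ψ` satisfies
`U ψ = c ψ` for some scalar `c` (the ground space is one-dimensional and `U`-invariant).
Tasaki (2020) §2.1. [folklore] -/
theorem HasSpectralGap.exists_mulVec_eq_smul {A U : Matrix n n ℂ} {Δ : ℝ}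
    (h : A.HasSpectralGap Δ) (hU : U * A = A * U) {ψ : n → ℂ} (hψ : A.IsGroundStateVector ψ) :
    ∃ c : ℂ, U *ᵥ ψ = c • ψ := by
  have h1 : Module.finrank ℂ A.groundSpace = 1 := h.hasUniqueGroundState
  obtain ⟨hne, hmem⟩ := (isGroundStateVector_iff A ψ).1 hψ
  have hU' : U *ᵥ ψ ∈ A.groundSpace := mulVec_mem_groundSpace_of_commute hU hmem
  have hv : (⟨ψ, hmem⟩ : A.groundSpace) ≠ 0 := fun h0 => hne (congrArg Subtype.val h0)
  obtain ⟨c, hc⟩ := (finrank_eq_one_iff_of_nonzero' _ hv).1 h1 ⟨U *ᵥ ψ, hU'⟩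
  exact ⟨c, (congrArg Subtype.val hc).symm⟩

/-- **Second variational principle under a spectral gap.** If `A.HasSpectralGap Δ`, `ψ ≠ 0` is a
ground-state vector and `φ ⊥ ψ`, then `re ⟨φ, A φ⟩ ≥ (E₀ + Δ) ⟨φ, φ⟩`: expanding `φ` in an
orthonormal eigenbasis, the coefficient along the (one-dimensional) ground space vanishes and all
other eigenvalues are `≥ E₀ + Δ`. Tasaki (2020) §2.1; Reed–Simon IV, Thm. XIII.1 (min–max).
[folklore] -/
theorem HasSpectralGap.le_rayleigh_of_orthogonal {A : Matrix n n ℂ} {Δ : ℝ}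
    (h : A.HasSpectralGap Δ) {ψ φ : n → ℂ} (hψ : A.IsGroundStateVector ψ)
    (horth : star ψ ⬝ᵥ φ = 0) :
    (A.groundEnergy + Δ) * (star φ ⬝ᵥ φ).re ≤ (star φ ⬝ᵥ A *ᵥ φ).re := by
  have hA : A.IsHermitian := h.isHermitian
  obtain ⟨-, hcard, hrange⟩ := (hA.hasSpectralGap_iff_card_filter Δ).1 h
  obtain ⟨hne, hmem⟩ := (isGroundStateVector_iff A ψ).1 hψ
  -- the unique index carrying the ground energy
  obtain ⟨i₀, hi₀⟩ := Finset.card_eq_one.1 hcard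
  have hother : ∀ i, i ≠ i₀ → A.groundEnergy + Δ ≤ hA.eigenvalues i := by
    intro i hi
    rcases hrange ⟨i, rfl⟩ with h0 | h1
    · exfalso
      have : i ∈ ({i₀} : Finset n) := by
        rw [← hi₀, Finset.mem_filter]
        exact ⟨Finset.mem_univ _, h0⟩
      exact hi (Finset.mem_singleton.1 this)
    · exact h1
  -- the eigenvector `b i₀` spans the ground space, hence is orthogonal to `φ`
  set b := hA.eigenvectorBasis with hb
  have hbi₀ : (b i₀).ofLp ∈ A.groundSpace := by
    have hval : hA.eigenvalues i₀ = A.groundEnergy := by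
      have : i₀ ∈ Finset.univ.filter fun i => hA.eigenvalues i = A.groundEnergy := by
        rw [hi₀]; exact Finset.mem_singleton_self _
      exact (Finset.mem_filter.1 this).2
    rw [mem_groundSpace_iff, hA.mulVec_eigenvectorBasis i₀, hval, Complex.coe_smul]
  have h1 : Module.finrank ℂ A.groundSpace = 1 := h.hasUniqueGroundState
  have hv : (⟨ψ, hmem⟩ : A.groundSpace) ≠ 0 := fun h0 => hne (congrArg Subtype.val h0)
  obtain ⟨c, hc⟩ := (finrank_eq_one_iff_of_nonzero' _ hv).1 h1 ⟨(b i₀).ofLp, hbi₀⟩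
  have hc' : (b i₀).ofLp = c • ψ := (congrArg Subtype.val hc).symm
  set x : EuclideanSpace ℂ n := WithLp.toLp 2 φ with hx
  have horth' : ⟪b i₀, x⟫_ℂ = 0 := by
    rw [EuclideanSpace.inner_eq_star_dotProduct, hc', star_smul, dotProduct_smul, dotProduct_comm,
      horth, smul_zero]
  -- expansion of the quadratic form and of the norm in the eigenbasis
  set T := toEuclideanCLM (n := n) (𝕜 := ℂ) A with hT
  have hTb : ∀ i, T (b i) = (hA.eigenvalues i : ℂ) • b i := by
    intro i
    have h2 : T (b i) = WithLp.toLp 2 (A *ᵥ (b i).ofLp) := by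
      rw [hT, ← toEuclideanCLM_toLp]
    rw [h2, hA.mulVec_eigenvectorBasis i]
    rfl
  have hsymm : ∀ i, ⟪b i, T x⟫_ℂ = (hA.eigenvalues i : ℂ) * ⟪b i, x⟫_ℂ := by
    intro i
    have hsa : IsSelfAdjoint T := (isSelfAdjoint_toEuclideanCLM_iff A).2 hA
    rw [← ContinuousLinearMap.adjoint_inner_left, hsa.adjoint_eq, hTb, inner_smul_left,
      Complex.conj_ofReal]
  have hquad : star φ ⬝ᵥ A *ᵥ φ = ∑ i, (hA.eigenvalues i : ℂ) * (⟪b i, x⟫_ℂ * star ⟪b i, x⟫_ℂ) := by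
    rw [star_dotProduct_mulVec_eq_inner, ← b.sum_inner_mul_inner x (T x)]
    refine Finset.sum_congr rfl fun i _ => ?_
    rw [hsymm, ← inner_conj_symm x (b i)]
    simp only [Complex.star_def]
    ring
  have hnorm : (star φ ⬝ᵥ φ).re = ∑ i, ‖⟪b i, x⟫_ℂ‖ ^ 2 := by
    rw [star_dotProduct_self_re, b.sum_sq_norm_inner_right]
  have hquad_re : (star φ ⬝ᵥ A *ᵥ φ).re = ∑ i, hA.eigenvalues i * ‖⟪b i, x⟫_ℂ‖ ^ 2 := by
    rw [hquad, Complex.re_sum]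
    refine Finset.sum_congr rfl fun i _ => ?_
    rw [Complex.star_def, Complex.mul_conj, ← Complex.ofReal_mul, Complex.ofReal_re,
      Complex.normSq_eq_norm_sq]
  rw [hnorm, hquad_re, Finset.mul_sum]
  refine Finset.sum_le_sum fun i _ => ?_
  by_cases hi : i = i₀
  · subst hi
    rw [horth', norm_zero]
    simp
  · exact mul_le_mul_of_nonneg_right (hother i hi) (sq_nonneg _)

end Matrix

namespace Matrix

open Literature.MathematicalPhysics.QuantumLattice

variable {n : Type*} [Fintype n] [DecidableEq n]

omit [DecidableEq n] in
/-- `⟨V ψ, A (V ψ)⟩ = ⟨ψ, (Vᴴ A V) ψ⟩`. [folklore] -/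
theorem star_mulVec_dotProduct_mulVec (A V : Matrix n n ℂ) (ψ : n → ℂ) :
    star (V *ᵥ ψ) ⬝ᵥ A *ᵥ (V *ᵥ ψ) = star ψ ⬝ᵥ (Vᴴ * A * V) *ᵥ ψ := by
  rw [star_mulVec, ← dotProduct_mulVec, mulVec_mulVec, mulVec_mulVec]

omit [DecidableEq n] in
/-- `⟨V ψ, V ψ⟩ = ⟨ψ, ψ⟩` for an isometry `V` (`Vᴴ V v = v`). [folklore] -/
theorem star_mulVec_dotProduct_self_of_unitary {V : Matrix n n ℂ} (hV : ∀ v, Vᴴ *ᵥ (V *ᵥ v) = v)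
    (ψ : n → ℂ) : star (V *ᵥ ψ) ⬝ᵥ (V *ᵥ ψ) = star ψ ⬝ᵥ ψ := by
  rw [star_mulVec, ← dotProduct_mulVec, hV]

omit [DecidableEq n] in
/-- `⟨ψ, Vᴴ ψ⟩ = conj ⟨ψ, V ψ⟩` (cf. `Matrix.star_dotProduct_conjTranspose_mulVec` of
`PairCorrelationsSupRayleighProofs`, not imported here). [folklore] -/
theorem star_dotProduct_conjTranspose_mulVec_eq_star (V : Matrix n n ℂ) (ψ : n → ℂ) :
    star ψ ⬝ᵥ Vᴴ *ᵥ ψ = star (star ψ ⬝ᵥ V *ᵥ ψ) := by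
  rw [star_dotProduct, star_mulVec, conjTranspose_conjTranspose, ← dotProduct_mulVec]

omit [DecidableEq n] in
/-- An eigenvalue of an isometry (`Tᴴ T v = v`) at a nonzero eigenvector is unimodular:
`conj c · c = 1`. [folklore] -/
theorem star_mul_self_eq_one_of_unitary_eigen {T : Matrix n n ℂ} (hT : ∀ v, Tᴴ *ᵥ (T *ᵥ v) = v)
    {ψ : n → ℂ} {c : ℂ} (hψ : ψ ≠ 0) (hc : T *ᵥ ψ = c • ψ) : star c * c = 1 := by
  have h1 := star_mulVec_dotProduct_self_of_unitary hT ψ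
  rw [hc, star_smul, smul_dotProduct, dotProduct_smul, smul_smul] at h1
  have hne : star ψ ⬝ᵥ ψ ≠ 0 := by
    rw [Ne, dotProduct_star_self_eq_zero]
    exact hψ
  have h2 : (star c * c - 1) * (star ψ ⬝ᵥ ψ) = 0 := by
    rw [sub_mul, one_mul, sub_eq_zero]
    exact h1
  rcases mul_eq_zero.1 h2 with h | h
  · exact sub_eq_zero.1 h
  · exact absurd h hne

omit [DecidableEq n] in
/-- **The twisted expectation vanishes.** If `T` is an isometry, `ψ ≠ 0` is a `T`-eigenvector and
the operator `V` satisfies the twisted commutation `V (T ψ) = c · T (V ψ)` on `ψ` with `c ≠ 1`,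
then `⟨ψ, V ψ⟩ = 0` (Lieb–Schultz–Mattis' orthogonality argument: `T V T⁻¹ = e^{2πi N/L} V`).
Lieb–Schultz–Mattis, Ann. Phys. 16 (1961) 407, App. B. [folklore] -/
theorem star_dotProduct_mulVec_eq_zero_of_twisted_commute {T V : Matrix n n ℂ}
    (hT : ∀ v, Tᴴ *ᵥ (T *ᵥ v) = v) {ψ : n → ℂ} {lam c : ℂ} (hψ : ψ ≠ 0)
    (hlam : T *ᵥ ψ = lam • ψ) (hc : V *ᵥ (T *ᵥ ψ) = c • (T *ᵥ (V *ᵥ ψ))) (hc1 : c ≠ 1) :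
    star ψ ⬝ᵥ V *ᵥ ψ = 0 := by
  have hunit : star lam * lam = 1 := star_mul_self_eq_one_of_unitary_eigen hT hψ hlam
  -- `⟨Tψ, V Tψ⟩` computed in two ways
  have h1 : star (T *ᵥ ψ) ⬝ᵥ V *ᵥ (T *ᵥ ψ) = star ψ ⬝ᵥ V *ᵥ ψ := by
    rw [hlam, mulVec_smul, star_smul, smul_dotProduct, dotProduct_smul, smul_smul, hunit, one_smul]
  have h2 : star (T *ᵥ ψ) ⬝ᵥ V *ᵥ (T *ᵥ ψ) = c * (star ψ ⬝ᵥ V *ᵥ ψ) := by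
    rw [hc, dotProduct_smul, smul_eq_mul, star_mulVec, ← dotProduct_mulVec, hT]
  have h3 : (c - 1) * (star ψ ⬝ᵥ V *ᵥ ψ) = 0 := by rw [sub_mul, one_mul, ← h2, h1, sub_self]
  rcases mul_eq_zero.1 h3 with h | h
  · exact absurd (sub_eq_zero.1 h) hc1
  · exact h

omit [DecidableEq n] in
/-- `re ⟨ψ, ψ⟩ > 0` for `ψ ≠ 0`. [folklore] -/
theorem star_dotProduct_self_re_pos {ψ : n → ℂ} (hψ : ψ ≠ 0) : 0 < (star ψ ⬝ᵥ ψ).re := by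
  rw [star_dotProduct_self_re]
  have : (WithLp.toLp 2 ψ : EuclideanSpace ℂ n) ≠ 0 := by
    intro h
    apply hψ
    have h' := congrArg WithLp.ofLp h
    simpa using h'
  positivity

/-- **The Lieb–Schultz–Mattis variational bound, abstract form.** Let `A` have a unique ground state
`ψ` with spectral gap `Δ`, let `V` be unitary with both twisted states `V ψ`, `Vᴴ ψ` orthogonal to
`ψ`, suppose `Vᴴ A V + V A Vᴴ = 2A + 2P` and that the form of `P` is bounded by `B`. Then
`Δ ≤ B`: each twisted state has energy `≥ E₀ + Δ` by the second variational principle, while the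
average of their energies exceeds `E₀ ⟨ψ, ψ⟩` by only `re ⟨ψ, P ψ⟩ ≤ B ⟨ψ, ψ⟩`.
Lieb–Schultz–Mattis, Ann. Phys. 16 (1961) 407, App. B; Tasaki (2018) §2.2.
[cite: LiebSchultzMattisAP1961, App. B Thm. 2] -/
theorem HasSpectralGap.gap_le_of_twist {A V P : Matrix n n ℂ} {Δ B : ℝ}
    (h : A.HasSpectralGap Δ) {ψ : n → ℂ} (hψ : A.IsGroundStateVector ψ)
    (hV : ∀ v, Vᴴ *ᵥ (V *ᵥ v) = v) (hV' : ∀ v, V *ᵥ (Vᴴ *ᵥ v) = v)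
    (h1 : star ψ ⬝ᵥ V *ᵥ ψ = 0) (h2 : star ψ ⬝ᵥ Vᴴ *ᵥ ψ = 0)
    (hP : Vᴴ * A * V + V * A * Vᴴ = (2 : ℂ) • A + (2 : ℂ) • P)
    (hB : ∀ φ : n → ℂ, (star φ ⬝ᵥ P *ᵥ φ).re ≤ B * (star φ ⬝ᵥ φ).re) : Δ ≤ B := by
  obtain ⟨hne, hAψ⟩ := hψ
  set N := (star ψ ⬝ᵥ ψ).re with hN
  have hNpos : 0 < N := star_dotProduct_self_re_pos hne
  -- energies of the two twisted states
  have e1 := h.le_rayleigh_of_orthogonal ⟨hne, hAψ⟩ h1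
  have e2 := h.le_rayleigh_of_orthogonal ⟨hne, hAψ⟩ h2
  rw [star_mulVec_dotProduct_self_of_unitary hV, star_mulVec_dotProduct_mulVec] at e1
  have hV'' : ∀ v, (Vᴴ)ᴴ *ᵥ (Vᴴ *ᵥ v) = v := by simpa only [conjTranspose_conjTranspose] using hV'
  rw [star_mulVec_dotProduct_self_of_unitary hV'', star_mulVec_dotProduct_mulVec,
    conjTranspose_conjTranspose] at e2
  -- their sum
  have hsum : (star ψ ⬝ᵥ (Vᴴ * A * V) *ᵥ ψ).re + (star ψ ⬝ᵥ (V * A * Vᴴ) *ᵥ ψ).re =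
      2 * (A.groundEnergy * N) + 2 * (star ψ ⬝ᵥ P *ᵥ ψ).re := by
    rw [← Complex.add_re, ← dotProduct_add, ← add_mulVec, hP, add_mulVec, smul_mulVec,
      smul_mulVec, hAψ, dotProduct_add, dotProduct_smul, dotProduct_smul, dotProduct_smul,
      Complex.add_re]
    simp only [smul_eq_mul, Complex.mul_re, Complex.ofReal_re, Complex.ofReal_im, zero_mul,
      sub_zero, hN]
    norm_num
  have hPle : (star ψ ⬝ᵥ P *ᵥ ψ).re ≤ B * N := hB ψ
  have key : Δ * N ≤ B * N := by nlinarith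
  exact le_of_mul_le_mul_right key hNpos

/-- The operator-norm form: under the hypotheses of `gap_le_of_twist`, `Δ ≤ ‖P‖`
(`ℓ²` operator norm). [folklore] -/
theorem HasSpectralGap.gap_le_norm_of_twist {A V P : Matrix n n ℂ} {Δ : ℝ}
    (h : A.HasSpectralGap Δ) {ψ : n → ℂ} (hψ : A.IsGroundStateVector ψ)
    (hV : ∀ v, Vᴴ *ᵥ (V *ᵥ v) = v) (hV' : ∀ v, V *ᵥ (Vᴴ *ᵥ v) = v)
    (h1 : star ψ ⬝ᵥ V *ᵥ ψ = 0) (h2 : star ψ ⬝ᵥ Vᴴ *ᵥ ψ = 0)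
    (hP : Vᴴ * A * V + V * A * Vᴴ = (2 : ℂ) • A + (2 : ℂ) • P) : Δ ≤ ‖P‖ :=
  h.gap_le_of_twist hψ hV hV' h1 h2 hP fun φ =>
    (le_abs_self _).trans (abs_re_star_dotProduct_mulVec_le P φ)

end Matrix

/-! ### Fock-space operators: the unitary phase twist and the signed relabelling unitary -/

namespace Literature.MathematicalPhysics.QuantumLattice

open Matrix Finset HubbardWave0 Literature.Probability.LatticeModels Complex

section Twist

variable {ι : Type*} [LinearOrder ι]

/-- The unitary `U(1)` phase twist `exp[i Σ_k θ_k n_k]` on the fermionic Fock space, as the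
diagonal matrix `|s⟩ ↦ e^{i Σ_{k ∈ s} θ_k} |s⟩` of the occupation basis (the unitary counterpart of
Koma–Tasaki's `gaugeMatrix`; Lieb–Schultz–Mattis' twist operator when `θ_k` grows linearly along
the chain). Lieb–Schultz–Mattis, Ann. Phys. 16 (1961) 407; Koma–Tasaki, PRL 68 (1992) 3248,
eq. (5). [folklore] -/
def fockTwist (θ : ι → ℝ) : Matrix (Finset ι) (Finset ι) ℂ :=
  diagonal fun s => cexp (((∑ i ∈ s, θ i : ℝ) : ℂ) * I)

/-- `fockTwist θ` unfolded. [folklore] -/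
theorem fockTwist_eq (θ : ι → ℝ) :
    fockTwist θ = diagonal fun s => cexp (((∑ i ∈ s, θ i : ℝ) : ℂ) * I) := rfl

/-- The twist of `-θ` has the inverse phases. [folklore] -/
theorem fockTwist_neg_eq (θ : ι → ℝ) :
    fockTwist (-θ) = diagonal fun s => cexp (-(((∑ i ∈ s, θ i : ℝ) : ℂ) * I)) := by
  rw [fockTwist]
  congr 1
  funext s
  simp only [Pi.neg_apply, sum_neg_distrib, ofReal_neg, neg_mul]

variable [Fintype ι]

/-- `U(θ) U(-θ) = 1`. [folklore] -/
theorem fockTwist_mul_fockTwist_neg (θ : ι → ℝ) : fockTwist θ * fockTwist (-θ) = 1 := by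
  rw [fockTwist_neg_eq, fockTwist, diagonal_mul_diagonal, ← diagonal_one]
  congr 1
  funext s
  rw [← Complex.exp_add, add_neg_cancel, Complex.exp_zero]

/-- `U(-θ) U(θ) = 1`. [folklore] -/
theorem fockTwist_neg_mul_fockTwist (θ : ι → ℝ) : fockTwist (-θ) * fockTwist θ = 1 := by
  simpa using fockTwist_mul_fockTwist_neg (-θ)

omit [Fintype ι] in
/-- The twist is unitary: `U(θ)ᴴ = U(-θ)`. [folklore] -/
theorem conjTranspose_fockTwist (θ : ι → ℝ) : (fockTwist θ)ᴴ = fockTwist (-θ) := by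
  rw [fockTwist, diagonal_conjTranspose, fockTwist_neg_eq]
  congr 1
  funext s
  rw [Pi.star_apply, Complex.star_def, ← Complex.exp_conj, map_mul, Complex.conj_ofReal,
    Complex.conj_I, mul_neg]

/-- `U(θ)ᴴ U(θ) = 1`. [folklore] -/
theorem conjTranspose_fockTwist_mul_self (θ : ι → ℝ) : (fockTwist θ)ᴴ * fockTwist θ = 1 := by
  rw [conjTranspose_fockTwist, fockTwist_neg_mul_fockTwist]

/-- `U(θ) U(θ)ᴴ = 1`. [folklore] -/
theorem fockTwist_mul_conjTranspose_self (θ : ι → ℝ) : fockTwist θ * (fockTwist θ)ᴴ = 1 := by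
  rw [conjTranspose_fockTwist, fockTwist_mul_fockTwist_neg]

/-- `U(θ)ᴴ (U(θ) v) = v`. [folklore] -/
theorem conjTranspose_fockTwist_mulVec_mulVec (θ : ι → ℝ) (v : Fock ι) :
    (fockTwist θ)ᴴ *ᵥ (fockTwist θ *ᵥ v) = v := by
  rw [mulVec_mulVec, conjTranspose_fockTwist_mul_self, one_mulVec]

/-- `U(θ) (U(θ)ᴴ v) = v`. [folklore] -/
theorem fockTwist_mulVec_conjTranspose_mulVec (θ : ι → ℝ) (v : Fock ι) :
    fockTwist θ *ᵥ ((fockTwist θ)ᴴ *ᵥ v) = v := by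
  rw [mulVec_mulVec, fockTwist_mul_conjTranspose_self, one_mulVec]

/-- Action on vectors: `(U(θ) ψ)(s) = e^{i Σ_s θ} ψ(s)`. [folklore] -/
theorem fockTwist_mulVec_apply (θ : ι → ℝ) (ψ : Fock ι) (s : Finset ι) :
    (fockTwist θ *ᵥ ψ) s = cexp (((∑ i ∈ s, θ i : ℝ) : ℂ) * I) * ψ s := by
  rw [fockTwist, mulVec_diagonal]

/-- **Twisting an annihilation operator**: `U(θ) c_j U(θ)⁻¹ = e^{-iθ_j} c_j`.
Lieb–Schultz–Mattis (1961), App. B; Koma–Tasaki (1992), eq. (8). [folklore] -/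
theorem fockTwist_mul_annihilation_mul (θ : ι → ℝ) (j : ι) :
    fockTwist θ * annihilation j * fockTwist (-θ) = cexp (-((θ j : ℂ) * I)) • annihilation j := by
  ext s t
  simp only [fockTwist, diagonal_mul, mul_diagonal, Matrix.smul_apply, smul_eq_mul, annihilation,
    Pi.neg_apply, sum_neg_distrib]
  split_ifs with h
  · rw [h.2, sum_insert h.1]
    have : cexp (((∑ i ∈ s, θ i : ℝ) : ℂ) * I) * jwSign j s *
        cexp (((-(θ j + ∑ i ∈ s, θ i) : ℝ) : ℂ) * I) =
        (cexp (((∑ i ∈ s, θ i : ℝ) : ℂ) * I) * cexp (((-(θ j + ∑ i ∈ s, θ i) : ℝ) : ℂ) * I)) *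
          jwSign j s := by ring
    rw [this, ← Complex.exp_add]
    congr 2
    push_cast
    ring
  · simp

/-- **Twisting a creation operator**: `U(θ) c†_j U(θ)⁻¹ = e^{iθ_j} c†_j`. [folklore] -/
theorem fockTwist_mul_creation_mul (θ : ι → ℝ) (j : ι) :
    fockTwist θ * creation j * fockTwist (-θ) = cexp ((θ j : ℂ) * I) • creation j := by
  have h := congrArg conjTranspose (fockTwist_mul_annihilation_mul θ j)
  rw [conjTranspose_mul, conjTranspose_mul, conjTranspose_fockTwist, conjTranspose_fockTwist,
    neg_neg, annihilation_conjTranspose, conjTranspose_smul, annihilation_conjTranspose,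
    ← mul_assoc] at h
  rw [h]
  congr 1
  rw [Complex.star_def, ← Complex.exp_conj, map_neg, map_mul, Complex.conj_ofReal, Complex.conj_I,
    mul_neg, neg_neg]

/-- Conjugation by the twist is multiplicative. [folklore] -/
theorem fockTwist_conj_mul (θ : ι → ℝ) (X Y : Matrix (Finset ι) (Finset ι) ℂ) :
    fockTwist θ * (X * Y) * fockTwist (-θ) =
      fockTwist θ * X * fockTwist (-θ) * (fockTwist θ * Y * fockTwist (-θ)) := by
  calc fockTwist θ * (X * Y) * fockTwist (-θ)
      = fockTwist θ * X * (fockTwist (-θ) * fockTwist θ) * Y * fockTwist (-θ) := by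
        rw [fockTwist_neg_mul_fockTwist]; noncomm_ring
    _ = fockTwist θ * X * fockTwist (-θ) * (fockTwist θ * Y * fockTwist (-θ)) := by
        noncomm_ring

/-- Number operators are invariant under the twist. [folklore] -/
theorem fockTwist_mul_numberAt_mul (θ : ι → ℝ) (j : ι) :
    fockTwist θ * numberAt j * fockTwist (-θ) = numberAt j := by
  rw [numberAt, fockTwist_conj_mul, fockTwist_mul_creation_mul, fockTwist_mul_annihilation_mul,
    smul_mul_smul, ← Complex.exp_add, add_neg_cancel, Complex.exp_zero, one_smul]

end Twist

section RelabelOp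

variable {ι ι' : Type*} [LinearOrder ι] [LinearOrder ι'] [Fintype ι] [Fintype ι']

/-- The signed permutation unitary `Γ_e : |s⟩ ↦ ε_e(s) |e(s)⟩` of the occupation bases implementing
the relabelling `relabel e` of `FermionRelabelling` (`relabel e a = Γ_e a Γ_eᴴ`,
`relabel_eq_relabelOp_conj`). Bratteli–Robinson II, Thm. 5.2.5. [folklore] -/
def relabelOp (e : ι ≃ ι') : Matrix (Finset ι') (Finset ι) ℂ :=
  Matrix.of fun s' s => if e.finsetCongr.symm s' = s then relabelSign e s else 0

omit [Fintype ι] [Fintype ι'] in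
/-- Entries of `relabelOp`. [folklore] -/
theorem relabelOp_apply (e : ι ≃ ι') (s' : Finset ι') (s : Finset ι) :
    relabelOp e s' s = if e.finsetCongr.symm s' = s then relabelSign e s else 0 := rfl

omit [Fintype ι'] in
/-- Action on vectors: `(Γ_e ψ)(s') = ε(e⁻¹ s') ψ(e⁻¹ s')`. [folklore] -/
theorem relabelOp_mulVec_apply (e : ι ≃ ι') (ψ : Fock ι) (s' : Finset ι') :
    (relabelOp e *ᵥ ψ) s' =
      relabelSign e (e.finsetCongr.symm s') * ψ (e.finsetCongr.symm s') := by
  simp only [mulVec, dotProduct, relabelOp_apply, ite_mul, zero_mul, Finset.sum_ite_eq,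
    Finset.mem_univ, if_true]

omit [Fintype ι] [Fintype ι'] in
/-- Entries of `relabelOpᴴ` (the signs are real). [folklore] -/
theorem conjTranspose_relabelOp_apply (e : ι ≃ ι') (s : Finset ι) (s' : Finset ι') :
    (relabelOp e)ᴴ s s' = if e.finsetCongr.symm s' = s then relabelSign e s else 0 := by
  rw [conjTranspose_apply, relabelOp_apply]
  split_ifs
  · exact star_relabelSign e s
  · exact star_zero _

/-- `Γ_eᴴ Γ_e = 1`. [folklore] -/
theorem conjTranspose_relabelOp_mul_self (e : ι ≃ ι') : (relabelOp e)ᴴ * relabelOp e = 1 := by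
  ext s t
  rw [mul_apply, ← e.finsetCongr.sum_comp, Finset.sum_eq_single s]
  · simp only [conjTranspose_apply, relabelOp_apply, Equiv.symm_apply_apply, if_true, one_apply]
    split_ifs with h
    · subst h
      rw [star_relabelSign, relabelSign_mul_self]
    · rw [mul_zero]
  · intro v _ hv
    simp only [conjTranspose_apply, relabelOp_apply, Equiv.symm_apply_apply, if_neg hv, star_zero,
      zero_mul]
  · exact fun h => absurd (Finset.mem_univ _) h

omit [Fintype ι'] in
/-- `Γ_e Γ_eᴴ = 1`. [folklore] -/
theorem relabelOp_mul_conjTranspose_self (e : ι ≃ ι') : relabelOp e * (relabelOp e)ᴴ = 1 := by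
  ext s' t'
  rw [mul_apply, Finset.sum_eq_single (e.finsetCongr.symm s')]
  · simp only [conjTranspose_apply, relabelOp_apply, if_true, one_apply]
    by_cases h : s' = t'
    · subst h
      rw [if_pos rfl, if_pos rfl, star_relabelSign, relabelSign_mul_self]
    · rw [if_neg h, if_neg (fun h' => h (e.finsetCongr.symm.injective h'.symm)), star_zero,
        mul_zero]
  · intro v _ hv
    rw [relabelOp_apply, if_neg (Ne.symm hv), zero_mul]
  · exact fun h => absurd (Finset.mem_univ _) h

/-- `Γ_eᴴ (Γ_e v) = v`. [folklore] -/
theorem conjTranspose_relabelOp_mulVec_mulVec (e : ι ≃ ι') (v : Fock ι) :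
    (relabelOp e)ᴴ *ᵥ (relabelOp e *ᵥ v) = v := by
  rw [mulVec_mulVec, conjTranspose_relabelOp_mul_self, one_mulVec]

/-- **The relabelling is conjugation by the signed permutation unitary**:
`relabel e a = Γ_e a Γ_eᴴ`. Bratteli–Robinson II, Thm. 5.2.5. [folklore] -/
theorem relabel_eq_relabelOp_conj (e : ι ≃ ι') (a : Matrix (Finset ι) (Finset ι) ℂ) :
    relabel e a = relabelOp e * a * (relabelOp e)ᴴ := by
  ext s' t'
  obtain ⟨s, rfl⟩ := e.finsetCongr.surjective s'
  obtain ⟨t, rfl⟩ := e.finsetCongr.surjective t'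
  rw [relabel_apply_finsetCongr, mul_apply]
  simp only [mul_apply, relabelOp_apply, conjTranspose_relabelOp_apply, Equiv.symm_apply_apply,
    ite_mul, zero_mul, Finset.sum_ite_eq, Finset.mem_univ, if_true, mul_ite, mul_zero]

/-- **A relabelling symmetry commutes with the operator**: if `relabel e a = a` then
`Γ_e a = a Γ_e`. [folklore] -/
theorem relabelOp_mul_eq_mul_relabelOp {e : ι ≃ ι} {a : Matrix (Finset ι) (Finset ι) ℂ}
    (h : relabel e a = a) : relabelOp e * a = a * relabelOp e := by
  rw [relabel_eq_relabelOp_conj] at h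
  calc relabelOp e * a = relabelOp e * a * ((relabelOp e)ᴴ * relabelOp e) := by
        rw [conjTranspose_relabelOp_mul_self, Matrix.mul_one]
    _ = relabelOp e * a * (relabelOp e)ᴴ * relabelOp e := by simp only [Matrix.mul_assoc]
    _ = a * relabelOp e := by rw [h]

end RelabelOp

section TwistTranslate

variable {ι : Type*} [LinearOrder ι] [Fintype ι]

/-- **Twisted commutation of twist and relabelling on a sector.** If on the support of `ψ` the
twist phases transform under `e` by a constant factor `c` (`e^{iΘ(e s)} = c e^{iΘ(s)}` whenever
`ψ(s) ≠ 0`), then `U(θ) Γ_e ψ = c Γ_e U(θ) ψ`. For the Lieb–Schultz–Mattis twist and the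
translation, `c = e^{2πi n/L}` on the `n`-particle sector. [folklore] -/
theorem fockTwist_mulVec_relabelOp_mulVec {θ : ι → ℝ} {e : ι ≃ ι} {c : ℂ} {ψ : Fock ι}
    (h : ∀ s, ψ s ≠ 0 → cexp (((∑ i ∈ e.finsetCongr s, θ i : ℝ) : ℂ) * I) =
      c * cexp (((∑ i ∈ s, θ i : ℝ) : ℂ) * I)) :
    fockTwist θ *ᵥ (relabelOp e *ᵥ ψ) = c • (relabelOp e *ᵥ (fockTwist θ *ᵥ ψ)) := by
  ext s'
  obtain ⟨s, rfl⟩ := e.finsetCongr.surjective s'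
  rw [fockTwist_mulVec_apply, relabelOp_mulVec_apply, Pi.smul_apply, relabelOp_mulVec_apply,
    fockTwist_mulVec_apply, Equiv.symm_apply_apply, smul_eq_mul]
  by_cases hs : ψ s = 0
  · simp [hs]
  · rw [h s hs]
    ring

end TwistTranslate


/-! ### Hopping operators with complex spin-dependent weights and the twisted Hubbard Hamiltonian -/

section SpinHop

variable {Λ : Type*} [LinearOrder Λ] [Fintype Λ]

/-- Hopping operator with complex, spin-dependent bond weights,
`T(w) = Σ_{u ∼ v} Σ_σ w(u, v, σ) c†_{uσ} c_{vσ}` (sum over ordered adjacent pairs); the twisted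
Hubbard hopping term has the unimodular weights `e^{i(θ_{uσ} - θ_{vσ})}` (Lieb–Schultz–Mattis'
`e^{iθ}`-deformed exchange; `hoppingForm` of `HubbardGaugeBound` is the real-weight case).
Lieb–Schultz–Mattis, Ann. Phys. 16 (1961) 407, App. B. [folklore] -/
def spinHop (G : SimpleGraph Λ) [DecidableRel G.Adj] (w : Λ → Λ → Fin 2 → ℂ) :
    Matrix (Finset (Orb Λ)) (Finset (Orb Λ)) ℂ :=
  ∑ u : Λ, ∑ v : Λ, ∑ σ : Fin 2,
    if G.Adj u v then w u v σ • (creation (orb u σ) * annihilation (orb v σ)) else 0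

variable (G : SimpleGraph Λ) [DecidableRel G.Adj]

/-- `spinHop` unfolded. [folklore] -/
theorem spinHop_eq (w : Λ → Λ → Fin 2 → ℂ) :
    spinHop G w = ∑ u : Λ, ∑ v : Λ, ∑ σ : Fin 2,
      if G.Adj u v then w u v σ • (creation (orb u σ) * annihilation (orb v σ)) else 0 := rfl

/-- Real bond weights: `hoppingForm G w = spinHop G w`. [folklore] -/
theorem hoppingForm_eq_spinHop (w : Λ → Λ → ℝ) :
    hoppingForm G w = spinHop G fun u v _ => ((w u v : ℝ) : ℂ) := rfl

/-- `spinHop` is additive in the weights. [folklore] -/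
theorem spinHop_add (w w' : Λ → Λ → Fin 2 → ℂ) :
    spinHop G w + spinHop G w' = spinHop G fun u v σ => w u v σ + w' u v σ := by
  simp only [spinHop, ← Finset.sum_add_distrib]
  refine Finset.sum_congr rfl fun u _ => Finset.sum_congr rfl fun v _ =>
    Finset.sum_congr rfl fun σ _ => ?_
  split_ifs
  · rw [← add_smul]
  · rw [add_zero]

/-- `spinHop` is homogeneous in the weights. [folklore] -/
theorem smul_spinHop (c : ℂ) (w : Λ → Λ → Fin 2 → ℂ) :
    c • spinHop G w = spinHop G fun u v σ => c * w u v σ := by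
  simp only [spinHop, Finset.smul_sum]
  refine Finset.sum_congr rfl fun u _ => Finset.sum_congr rfl fun v _ =>
    Finset.sum_congr rfl fun σ _ => ?_
  split_ifs
  · rw [smul_smul]
  · rw [smul_zero]

/-- **Twisting the hopping term**: `U(θ) T(w) U(θ)⁻¹ = T(w · e^{i(θ_{uσ} - θ_{vσ})})`.
Lieb–Schultz–Mattis (1961), App. B. [folklore] -/
theorem fockTwist_mul_spinHop_mul (θ : Orb Λ → ℝ) (w : Λ → Λ → Fin 2 → ℂ) :
    fockTwist θ * spinHop G w * fockTwist (-θ) =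
      spinHop G fun u v σ => w u v σ * cexp (((θ (orb u σ) - θ (orb v σ) : ℝ) : ℂ) * I) := by
  simp only [spinHop, Finset.mul_sum, Finset.sum_mul]
  refine Finset.sum_congr rfl fun u _ => Finset.sum_congr rfl fun v _ =>
    Finset.sum_congr rfl fun σ _ => ?_
  split_ifs with h
  · rw [Matrix.mul_smul, Matrix.smul_mul, fockTwist_conj_mul, fockTwist_mul_creation_mul,
      fockTwist_mul_annihilation_mul, smul_mul_smul, smul_smul]
    congr 1
    rw [← Complex.exp_add]
    push_cast
    ring_nf
  · rw [Matrix.mul_zero, Matrix.zero_mul]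

/-- Norm bound: `‖T(w)‖ ≤ Σ_{u ∼ v} Σ_σ ‖w(u, v, σ)‖` (`‖c†_{uσ} c_{vσ}‖ ≤ 1`). [folklore] -/
theorem norm_spinHop_le (w : Λ → Λ → Fin 2 → ℂ) :
    ‖spinHop G w‖ ≤ ∑ u : Λ, ∑ v : Λ, if G.Adj u v then ∑ σ : Fin 2, ‖w u v σ‖ else 0 := by
  rw [spinHop]
  refine (norm_sum_le _ _).trans (Finset.sum_le_sum fun u _ => ?_)
  refine (norm_sum_le _ _).trans (Finset.sum_le_sum fun v _ => ?_)
  by_cases h : G.Adj u v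
  · simp only [if_pos h]
    refine (norm_sum_le _ _).trans (Finset.sum_le_sum fun σ _ => ?_)
    rw [norm_smul]
    exact mul_le_of_le_one_right (norm_nonneg _) ((norm_mul_le _ _).trans
      (mul_le_one₀ (norm_creation_le_one _) (norm_nonneg _) (norm_annihilation_le_one _)))
  · simp [h]

/-- The density terms `U Σ n↑n↓ - μN` are invariant under the twist (number operators are).
[folklore] -/
theorem fockTwist_mul_densityTerms_mul (θ : Orb Λ → ℝ) (U μ : ℝ) :
    fockTwist θ * densityTerms U μ * fockTwist (-θ) = densityTerms U μ := by
  have hn : ∀ (u : Λ) (σ : Fin 2), fockTwist θ * numberOp u σ * fockTwist (-θ) = numberOp u σ :=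
    fun u σ => by rw [← numberAt_orb, fockTwist_mul_numberAt_mul]
  unfold densityTerms totalNumber
  simp only [Matrix.mul_sub, Matrix.sub_mul, Matrix.mul_smul, Matrix.smul_mul, Finset.mul_sum,
    Finset.sum_mul, fockTwist_conj_mul θ (numberOp _ 0), hn]

/-- **The twisted grand-canonical Hubbard Hamiltonian**:
`U(θ) (H(t,U) - μN) U(θ)⁻¹ = -t T(e^{i(θ_{uσ} - θ_{vσ})}) + (U Σ n n - μ N)`.
Lieb–Schultz–Mattis (1961), App. B; Yamanaka–Oshikawa–Affleck, PRL 79 (1997) 1110. [folklore] -/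
theorem fockTwist_mul_hamiltonianWith_mul (θ : Orb Λ → ℝ) (t U μ : ℝ) :
    fockTwist θ * hamiltonianWith G t U μ * fockTwist (-θ) =
      -(t : ℂ) • spinHop G (fun u v σ => cexp (((θ (orb u σ) - θ (orb v σ) : ℝ) : ℂ) * I)) +
        densityTerms U μ := by
  rw [hamiltonianWith_eq_hoppingForm, Matrix.mul_add, Matrix.add_mul, Matrix.mul_smul,
    Matrix.smul_mul, hoppingForm_eq_spinHop, fockTwist_mul_spinHop_mul,
    fockTwist_mul_densityTerms_mul]
  simp only [Complex.ofReal_one, one_mul]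

/-- The Lieb–Schultz–Mattis perturbation `P_θ = -t T(cos(θ_{uσ} - θ_{vσ}) - 1)` (the Hermitian
operator by which the average energy of the two oppositely twisted states exceeds `⟨H⟩`). [folklore] -/
def lsmPerturbation (θ : Orb Λ → ℝ) (t : ℝ) : Matrix (Finset (Orb Λ)) (Finset (Orb Λ)) ℂ :=
  -(t : ℂ) • spinHop G fun u v σ => ((Real.cos (θ (orb u σ) - θ (orb v σ)) - 1 : ℝ) : ℂ)

/-- **Sum of the two oppositely twisted Hamiltonians**:
`U(θ) H U(θ)⁻¹ + U(-θ) H U(-θ)⁻¹ = 2H + 2P_θ` with `P_θ = -t T(cos(θ_u - θ_v) - 1)`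
(`e^{iφ} + e^{-iφ} = 2 + 2(cos φ - 1)`). Lieb–Schultz–Mattis (1961), App. B, eq. (B-5). [folklore] -/
theorem fockTwist_conj_hamiltonianWith_add (θ : Orb Λ → ℝ) (t U μ : ℝ) :
    fockTwist θ * hamiltonianWith G t U μ * fockTwist (-θ) +
        fockTwist (-θ) * hamiltonianWith G t U μ * fockTwist θ =
      (2 : ℂ) • hamiltonianWith G t U μ + (2 : ℂ) • lsmPerturbation G θ t := by
  have h2 := fockTwist_mul_hamiltonianWith_mul G (-θ) t U μ
  rw [neg_neg] at h2
  rw [fockTwist_mul_hamiltonianWith_mul, h2, lsmPerturbation, hamiltonianWith_eq_hoppingForm,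
    hoppingForm_eq_spinHop]
  have hw : spinHop G (fun u v σ => cexp (((θ (orb u σ) - θ (orb v σ) : ℝ) : ℂ) * I)) +
      spinHop G (fun u v σ => cexp ((((-θ) (orb u σ) - (-θ) (orb v σ) : ℝ) : ℂ) * I)) =
      (2 : ℂ) • spinHop G (fun _ _ _ => ((1 : ℝ) : ℂ)) +
        (2 : ℂ) • spinHop G (fun u v σ => ((Real.cos (θ (orb u σ) - θ (orb v σ)) - 1 : ℝ) : ℂ)) := by
    rw [spinHop_add, smul_spinHop, smul_spinHop, spinHop_add]
    congr 1
    funext u v σ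
    simp only [Pi.neg_apply]
    rw [show ((-θ (orb u σ) - -θ (orb v σ) : ℝ) : ℂ) * I = -(((θ (orb u σ) - θ (orb v σ) : ℝ) : ℂ)) * I
      by push_cast; ring, ← Complex.two_cos, ← Complex.ofReal_cos]
    push_cast
    ring
  calc -(t : ℂ) • spinHop G (fun u v σ => cexp (((θ (orb u σ) - θ (orb v σ) : ℝ) : ℂ) * I)) +
          densityTerms U μ +
        (-(t : ℂ) • spinHop G (fun u v σ => cexp ((((-θ) (orb u σ) - (-θ) (orb v σ) : ℝ) : ℂ) * I)) +
          densityTerms U μ)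
      = -(t : ℂ) • (spinHop G (fun u v σ => cexp (((θ (orb u σ) - θ (orb v σ) : ℝ) : ℂ) * I)) +
          spinHop G (fun u v σ => cexp ((((-θ) (orb u σ) - (-θ) (orb v σ) : ℝ) : ℂ) * I))) +
          (2 : ℂ) • densityTerms U μ := by
        rw [smul_add, two_smul]; abel
    _ = -(t : ℂ) • ((2 : ℂ) • spinHop G (fun _ _ _ => ((1 : ℝ) : ℂ)) +
          (2 : ℂ) • spinHop G (fun u v σ => ((Real.cos (θ (orb u σ) - θ (orb v σ)) - 1 : ℝ) : ℂ))) +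
          (2 : ℂ) • densityTerms U μ := by rw [hw]
    _ = (2 : ℂ) • (-(t : ℂ) • spinHop G (fun _ _ _ => ((1 : ℝ) : ℂ)) + densityTerms U μ) +
          (2 : ℂ) • (-(t : ℂ) • spinHop G
            (fun u v σ => ((Real.cos (θ (orb u σ) - θ (orb v σ)) - 1 : ℝ) : ℂ))) := by
        module

/-- Norm of the Lieb–Schultz–Mattis perturbation:
`‖P_θ‖ ≤ |t| Σ_{u ∼ v} Σ_σ |cos(θ_{uσ} - θ_{vσ}) - 1|`. [folklore] -/
theorem norm_lsmPerturbation_le (θ : Orb Λ → ℝ) (t : ℝ) :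
    ‖lsmPerturbation G θ t‖ ≤ |t| * ∑ u : Λ, ∑ v : Λ,
      if G.Adj u v then ∑ σ : Fin 2, |Real.cos (θ (orb u σ) - θ (orb v σ)) - 1| else 0 := by
  rw [lsmPerturbation, norm_smul, norm_neg, Complex.norm_real, Real.norm_eq_abs]
  refine mul_le_mul_of_nonneg_left ((norm_spinHop_le G _).trans (le_of_eq ?_)) (abs_nonneg t)
  refine Finset.sum_congr rfl fun u _ => Finset.sum_congr rfl fun v _ => ?_
  split_ifs
  · refine Finset.sum_congr rfl fun σ _ => ?_
    rw [Complex.norm_real, Real.norm_eq_abs]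
  · rfl

/-- Form bound of the Lieb–Schultz–Mattis perturbation:
`re ⟨φ, P_θ φ⟩ ≤ (|t| Σ_{u ∼ v} Σ_σ |cos(θ_{uσ} - θ_{vσ}) - 1|) ⟨φ, φ⟩`. [folklore] -/
theorem re_expect_lsmPerturbation_le (θ : Orb Λ → ℝ) (t : ℝ) (φ : Fock (Orb Λ)) :
    (star φ ⬝ᵥ lsmPerturbation G θ t *ᵥ φ).re ≤ (|t| * ∑ u : Λ, ∑ v : Λ,
      if G.Adj u v then ∑ σ : Fin 2, |Real.cos (θ (orb u σ) - θ (orb v σ)) - 1| else 0) *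
        (star φ ⬝ᵥ φ).re := by
  have hnn : 0 ≤ (star φ ⬝ᵥ φ).re := by
    rw [Matrix.star_dotProduct_self_re]; positivity
  exact (le_abs_self _).trans ((abs_re_star_dotProduct_mulVec_le _ φ).trans
    (mul_le_mul_of_nonneg_right (norm_lsmPerturbation_le G θ t) hnn))

end SpinHop


/-! ### Spin-resolved particle numbers in the occupation basis -/

section SpinCount

variable {Λ : Type*} [LinearOrder Λ] [Fintype Λ]

/-- The number of spin-`σ` orbitals in an occupation configuration `s ⊆ Λ × {↑, ↓}` (the
eigenvalue of `N_σ = Σ_x n_{xσ}` on `|s⟩`). Lieb, PRL 62 (1989) 1201. [folklore] -/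
def spinCount (σ : Fin 2) (s : Finset (Orb Λ)) : ℕ := (s.filter fun k => (ofLex k).2 = σ).card

omit [LinearOrder Λ] [Fintype Λ] in
/-- `spinCount` unfolded. [folklore] -/
theorem spinCount_eq (σ : Fin 2) (s : Finset (Orb Λ)) :
    spinCount σ s = (s.filter fun k => (ofLex k).2 = σ).card := rfl

omit [LinearOrder Λ] in
/-- The spin-`σ` orbitals of `s` are the orbitals `(x, σ)` with `(x, σ) ∈ s`. [folklore] -/
theorem filter_snd_eq_map (σ : Fin 2) (s : Finset (Orb Λ)) [DecidablePred fun x : Λ => orb x σ ∈ s] :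
    (s.filter fun k => (ofLex k).2 = σ) =
      ((Finset.univ : Finset Λ).filter fun x => orb x σ ∈ s).map
        ⟨fun x => orb x σ, fun _ _ h => (orb_eq_orb_iff.1 h).1⟩ := by
  classical
  ext k
  simp only [Finset.mem_filter, Finset.mem_map, Finset.mem_univ, true_and,
    Function.Embedding.coeFn_mk]
  constructor
  · rintro ⟨hk, hσ⟩
    refine ⟨(ofLex k).1, ?_, ?_⟩
    · have : orb (ofLex k).1 σ = k := by rw [← hσ]; rfl
      rwa [this]
    · rw [← hσ]; rfl
  · rintro ⟨x, hx, rfl⟩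
    exact ⟨hx, rfl⟩

/-- `N_σ |s⟩`: `Σ_x [ (x, σ) ∈ s ] = spinCount σ s`. [folklore] -/
theorem sum_ite_orb_mem (σ : Fin 2) (s : Finset (Orb Λ)) :
    (∑ x : Λ, if orb x σ ∈ s then (1 : ℕ) else 0) = spinCount σ s := by
  classical
  rw [spinCount, filter_snd_eq_map, Finset.card_map, Finset.card_filter]

omit [LinearOrder Λ] [Fintype Λ] in
/-- `N_↑ + N_↓ = N` on `|s⟩`. [folklore] -/
theorem spinCount_zero_add_spinCount_one (s : Finset (Orb Λ)) :
    spinCount 0 s + spinCount 1 s = s.card := by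
  rw [spinCount, spinCount]
  have h : (s.filter fun k => (ofLex k).2 = 1) = s.filter fun k => ¬ (ofLex k).2 = 0 := by
    refine Finset.filter_congr fun k _ => ?_
    constructor
    · intro h1 h0; rw [h0] at h1; exact absurd h1 (by decide)
    · intro h0; exact Fin.eq_one_of_ne_zero _ h0
  rw [h, Finset.card_filter_add_card_filter_not]

/-- `n_{xσ}` acts diagonally: `(n_{xσ} ψ)(s) = [ (x,σ) ∈ s ] ψ(s)`. [folklore] -/
theorem numberOp_mulVec_apply (x : Λ) (σ : Fin 2) (ψ : Fock (Orb Λ)) (s : Finset (Orb Λ)) :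
    (numberOp x σ *ᵥ ψ) s = (if orb x σ ∈ s then 1 else 0) * ψ s := by
  rw [← numberAt_orb, numberAt_eq_diagonal, mulVec_diagonal]

/-- `S^z` acts diagonally: `(S^z ψ)(s) = ½ (N_↑(s) - N_↓(s)) ψ(s)`. [folklore] -/
theorem spinZ_mulVec_apply (ψ : Fock (Orb Λ)) (s : Finset (Orb Λ)) :
    (spinZ *ᵥ ψ) s = (1 / 2 : ℂ) * ((spinCount 0 s : ℂ) - (spinCount 1 s : ℂ)) * ψ s := by
  rw [HubbardWave0.spinZ, smul_mulVec, Pi.smul_apply, smul_eq_mul, mul_assoc]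
  congr 1
  rw [Matrix.sum_mulVec, Finset.sum_apply]
  simp only [sub_mulVec, Pi.sub_apply, numberOp_mulVec_apply, ← sub_mul]
  rw [← sum_ite_orb_mem 0 s, ← sum_ite_orb_mem 1 s, ← Finset.sum_mul, Finset.sum_sub_distrib]
  simp only [Nat.cast_sum, Nat.cast_ite, Nat.cast_one, Nat.cast_zero]

/-- **Spin-resolved particle numbers in a joint sector.** A vector of `szSector N M` is supported
on configurations with exactly `N/2 + M` up-spins and `N/2 - M` down-spins
(`N_↑ = N/2 + S^z`, `N_↓ = N/2 - S^z`). Lieb, PRL 62 (1989) 1201. [folklore] -/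
theorem spinCount_eq_of_mem_szSector {N : ℕ} {M : ℝ} {ψ : Fock (Orb Λ)} (h : ψ ∈ szSector N M)
    {s : Finset (Orb Λ)} (hs : ψ s ≠ 0) :
    (spinCount 0 s : ℝ) = N / 2 + M ∧ (spinCount 1 s : ℝ) = N / 2 - M := by
  rw [mem_szSector_iff] at h
  obtain ⟨hN, hM⟩ := h
  have hcard : s.card = N := by
    by_contra hne
    exact hs (hN s hne)
  have hsum : (spinCount 0 s : ℝ) + spinCount 1 s = N := by
    rw [← hcard, ← spinCount_zero_add_spinCount_one s]
    push_cast
    rfl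
  have hz := congrFun hM s
  rw [spinZ_mulVec_apply, Pi.smul_apply, smul_eq_mul] at hz
  have hz' : (1 / 2 : ℂ) * ((spinCount 0 s : ℂ) - (spinCount 1 s : ℂ)) = (M : ℂ) :=
    mul_right_cancel₀ hs hz
  have hdiff : (1 / 2 : ℝ) * ((spinCount 0 s : ℝ) - spinCount 1 s) = M := by
    have := congrArg Complex.re hz'
    simpa using this
  constructor <;> linarith

end SpinCount

/-! ### The Lieb–Schultz–Mattis twist and the unit translation of the fermionic torus -/

section TorusTwist

open Real in
/-- The Lieb–Schultz–Mattis twist angles on the fermionic torus `ℤ_L^d`: the spin-`σ` orbital at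
site `x` is rotated by `2π x_{i₀} / L`, the other spin species is untouched
(`U_σ = exp[2πi L⁻¹ Σ_x x_{i₀} n_{xσ}]`). Lieb–Schultz–Mattis, Ann. Phys. 16 (1961) 407, App. B;
Yamanaka–Oshikawa–Affleck, PRL 79 (1997) 1110, eq. (2). [folklore] -/
def lsmTwist {d : ℕ} (L : ℕ) (i₀ : Fin d) (σ : Fin 2) : Orb (FermionTorus d L) → ℝ := fun k =>
  if (ofLex k).2 = σ then 2 * π / L * ((ofLex (ofLex k).1 i₀ : ℕ) : ℝ) else 0

/-- The unit translation `x ↦ x + e_{i₀}` of the torus `ℤ_L^d`, as a bijection of the Hubbard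
orbitals `(x, σ) ↦ (x + e_{i₀}, σ)`. [folklore] -/
def lsmShift {d L : ℕ} [NeZero L] (i₀ : Fin d) :
    Orb (FermionTorus d L) ≃ Orb (FermionTorus d L) :=
  Orb.mapEquiv (FermionTorus.ofTorusEquiv (Equiv.addRight (Pi.single i₀ (1 : ZMod L))))

variable {d L : ℕ}

/-- `lsmTwist` unfolded. [folklore] -/
theorem lsmTwist_apply (i₀ : Fin d) (σ : Fin 2) (k : Orb (FermionTorus d L)) :
    lsmTwist L i₀ σ k =
      if (ofLex k).2 = σ then 2 * Real.pi / L * ((ofLex (ofLex k).1 i₀ : ℕ) : ℝ) else 0 := rfl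

variable [NeZero L]

/-- The translation preserves the spin label. [folklore] -/
theorem snd_ofLex_lsmShift (i₀ : Fin d) (k : Orb (FermionTorus d L)) :
    (ofLex (lsmShift i₀ k)).2 = (ofLex k).2 := rfl

/-- The translation shifts the `i₀`-coordinate by one, modulo `L`. [folklore] -/
theorem coord_lsmShift (i₀ : Fin d) (k : Orb (FermionTorus d L)) :
    (ofLex (ofLex (lsmShift i₀ k)).1 i₀ : ℕ) = ((ofLex (ofLex k).1 i₀ : ℕ) + 1) % L := by
  have h1 : (ofLex (lsmShift i₀ k)).1 =
      FermionTorus.ofTorusSite (FermionTorus.toTorusSite (ofLex k).1 + Pi.single i₀ (1 : ZMod L)) :=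
    rfl
  rw [h1, FermionTorus.ofLex_ofTorusSite_apply, Pi.add_apply, Pi.single_eq_same,
    FermionTorus.toTorusSite_apply, ← Nat.cast_succ, ZMod.val_natCast]

/-- **Translation invariance of the torus Hubbard Hamiltonian** under the unit translation
(`FermionRelabelling.relabel_addRight_hubbardTorusWith`). [folklore] -/
theorem relabel_lsmShift_hubbardTorusWith (i₀ : Fin d) (t U μ : ℝ) :
    relabel (lsmShift (L := L) i₀) (hubbardTorusWith d L t U μ) = hubbardTorusWith d L t U μ :=
  relabel_addRight_hubbardTorusWith _ t U μ

/-- The translation unitary commutes with the torus Hubbard Hamiltonian. [folklore] -/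
theorem relabelOp_lsmShift_mul_hubbardTorusWith (i₀ : Fin d) (t U μ : ℝ) :
    relabelOp (lsmShift (L := L) i₀) * hubbardTorusWith d L t U μ =
      hubbardTorusWith d L t U μ * relabelOp (lsmShift (L := L) i₀) :=
  relabelOp_mul_eq_mul_relabelOp (relabel_lsmShift_hubbardTorusWith (L := L) i₀ t U μ)

/-- The twist angle of a translated orbital: `θ(k + e_{i₀}) = θ(k) + [σ_k = σ] (2π/L - 2π q_k)`
with the wrap-around count `q_k = ⌊(x_{i₀} + 1)/L⌋ ∈ {0, 1}`. [folklore] -/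
theorem lsmTwist_lsmShift (i₀ : Fin d) (σ : Fin 2) (k : Orb (FermionTorus d L)) :
    lsmTwist L i₀ σ (lsmShift i₀ k) = lsmTwist L i₀ σ k +
      if (ofLex k).2 = σ then
        2 * Real.pi / L - 2 * Real.pi * ((((ofLex (ofLex k).1 i₀ : ℕ) + 1) / L : ℕ) : ℝ) else 0 := by
  rw [lsmTwist_apply, lsmTwist_apply, snd_ofLex_lsmShift, coord_lsmShift]
  split_ifs with h
  · set a : ℕ := (ofLex (ofLex k).1 i₀ : ℕ) with ha
    have hL : (L : ℝ) ≠ 0 := by exact_mod_cast (NeZero.ne L)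
    have hmod : (((a + 1) % L : ℕ) : ℝ) = (a : ℝ) + 1 - (L : ℝ) * (((a + 1) / L : ℕ) : ℝ) := by
      have := Nat.mod_add_div (a + 1) L
      have h' : (((a + 1) % L : ℕ) : ℝ) + (L : ℝ) * (((a + 1) / L : ℕ) : ℝ) = (a : ℝ) + 1 := by
        exact_mod_cast this
      linarith
    rw [hmod]
    field_simp
    ring
  · simp

/-- **The twist phases of a translated configuration**: `Θ(s + e_{i₀}) = Θ(s) + 2π N_σ(s)/L - 2π Q`
for a natural number `Q` (the number of spin-`σ` particles of `s` wrapping around the torus).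
Lieb–Schultz–Mattis (1961), App. B (`T U T⁻¹ = U e^{2πi N/L}` up to the boundary term). [folklore] -/
theorem sum_lsmTwist_finsetCongr_lsmShift (i₀ : Fin d) (σ : Fin 2) (s : Finset (Orb (FermionTorus d L))) :
    ∃ Q : ℕ, ∑ k ∈ (lsmShift i₀).finsetCongr s, lsmTwist L i₀ σ k =
      ∑ k ∈ s, lsmTwist L i₀ σ k + 2 * Real.pi / L * spinCount σ s - 2 * Real.pi * Q := by
  refine ⟨∑ k ∈ s, if (ofLex k).2 = σ then (((ofLex (ofLex k).1 i₀ : ℕ) + 1) / L : ℕ) else 0, ?_⟩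
  rw [Equiv.finsetCongr_apply, Finset.sum_map]
  simp only [Equiv.coe_toEmbedding, lsmTwist_lsmShift, Finset.sum_add_distrib]
  rw [add_sub_assoc]
  congr 1
  rw [spinCount_eq, Finset.card_filter]
  push_cast
  rw [Finset.mul_sum, Finset.mul_sum, ← Finset.sum_sub_distrib]
  refine Finset.sum_congr rfl fun k _ => ?_
  split_ifs <;> ring

/-- On the sector with `N_σ = m` the Lieb–Schultz–Mattis twist and the unit translation commute
up to the phase `e^{2πi m/L}`: the hypothesis of `fockTwist_mulVec_relabelOp_mulVec`. [folklore] -/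
theorem cexp_sum_lsmTwist_lsmShift (i₀ : Fin d) (σ : Fin 2) {m : ℕ}
    {s : Finset (Orb (FermionTorus d L))} (hs : spinCount σ s = m) :
    cexp (((∑ k ∈ (lsmShift i₀).finsetCongr s, lsmTwist L i₀ σ k : ℝ) : ℂ) * I) =
      cexp (2 * Real.pi * I * m / L) * cexp (((∑ k ∈ s, lsmTwist L i₀ σ k : ℝ) : ℂ) * I) := by
  obtain ⟨Q, hQ⟩ := sum_lsmTwist_finsetCongr_lsmShift i₀ σ s
  rw [hQ, hs]
  have hre : (((∑ k ∈ s, lsmTwist L i₀ σ k + 2 * Real.pi / L * (m : ℝ) - 2 * Real.pi * (Q : ℝ) :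
      ℝ) : ℂ)) * I = ((∑ k ∈ s, lsmTwist L i₀ σ k : ℝ) : ℂ) * I + 2 * Real.pi * I * m / L -
        (Q : ℂ) * (2 * Real.pi * I) := by
    push_cast
    ring
  rw [hre, Complex.exp_sub, Complex.exp_add, Complex.exp_nat_mul_two_pi_mul_I, div_one, mul_comm]

/-- The phase `e^{2πi m/L}` is `1` only if `L ∣ m`. [folklore] -/
theorem cexp_two_pi_mul_div_ne_one {m : ℕ} (h : ¬ L ∣ m) :
    cexp (2 * Real.pi * I * m / L) ≠ 1 := by
  intro h1
  obtain ⟨n, hn⟩ := Complex.exp_eq_one_iff.1 h1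
  have hL : (L : ℂ) ≠ 0 := by exact_mod_cast (NeZero.ne L)
  have hpi : (2 * Real.pi * I : ℂ) ≠ 0 := by
    simp [Real.pi_ne_zero, Complex.I_ne_zero]
  rw [div_eq_iff hL] at hn
  have hm : (2 * Real.pi * I : ℂ) * (m : ℂ) = (2 * Real.pi * I) * (n * L) := by
    linear_combination hn
  have hm' : (m : ℂ) = n * L := mul_left_cancel₀ hpi hm
  have hm'' : (m : ℤ) = n * L := by exact_mod_cast hm'
  exact h (Int.natCast_dvd_natCast.1 ⟨n, by rw [hm'']; ring⟩)

end TorusTwist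


/-! ### Geometry of the torus: adjacent sites in one coordinate, neighbour count -/

section TorusGeometry

variable {d L : ℕ}

/-- Adjacent sites of the torus `ℤ_L^d` agree in the coordinate `i₀` or differ there by `±1 (mod L)`.
[folklore] -/
theorem coord_rel_of_adj (i₀ : Fin d) {u v : FermionTorus d L} (h : (fermionTorusGraph d L).Adj u v) :
    ((ofLex u i₀ : ℕ) : ZMod L) = ((ofLex v i₀ : ℕ) : ZMod L) ∨
      ((ofLex v i₀ : ℕ) : ZMod L) = (((ofLex u i₀ : ℕ) + 1 : ℕ) : ZMod L) ∨
      ((ofLex u i₀ : ℕ) : ZMod L) = (((ofLex v i₀ : ℕ) + 1 : ℕ) : ZMod L) := by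
  rw [fermionTorusGraph_adj, torusGraph_adj_iff] at h
  obtain ⟨-, ⟨i, hi⟩ | ⟨i, hi⟩⟩ := h
  · have h0 := congrFun hi i₀
    rw [Pi.add_apply, FermionTorus.toTorusSite_apply, FermionTorus.toTorusSite_apply,
      Pi.single_apply] at h0
    by_cases hi₀ : i₀ = i
    · rw [if_pos hi₀] at h0
      exact Or.inr (Or.inl (by rw [h0, Nat.cast_succ]))
    · rw [if_neg hi₀, add_zero] at h0
      exact Or.inl h0.symm
  · have h0 := congrFun hi i₀
    rw [Pi.add_apply, FermionTorus.toTorusSite_apply, FermionTorus.toTorusSite_apply,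
      Pi.single_apply] at h0
    by_cases hi₀ : i₀ = i
    · rw [if_pos hi₀] at h0
      exact Or.inr (Or.inr (by rw [h0, Nat.cast_succ]))
    · rw [if_neg hi₀, add_zero] at h0
      exact Or.inl h0

/-- The twist-angle difference across a bond: if `a ≡ b`, `b ≡ a + 1` or `a ≡ b + 1 (mod L)` then
`|cos(2π(a - b)/L) - 1| ≤ 1 - cos(2π/L)`. Lieb–Schultz–Mattis (1961), App. B. [folklore] -/
theorem abs_cos_sub_one_le_of_rel (hL : L ≠ 0) {a b : ℕ}
    (h : (a : ZMod L) = (b : ZMod L) ∨ (b : ZMod L) = ((a + 1 : ℕ) : ZMod L) ∨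
      (a : ZMod L) = ((b + 1 : ℕ) : ZMod L)) :
    |Real.cos (2 * Real.pi / L * a - 2 * Real.pi / L * b) - 1| ≤ 1 - Real.cos (2 * Real.pi / L) := by
  have hL' : (L : ℝ) ≠ 0 := by exact_mod_cast hL
  have hcos1 : Real.cos (2 * Real.pi / L) ≤ 1 := Real.cos_le_one _
  rcases h with h | h | h
  · rw [ZMod.natCast_eq_natCast_iff] at h
    obtain ⟨k, hk⟩ := Nat.modEq_iff_dvd.1 h
    have hk' : (b : ℝ) - a = L * k := by exact_mod_cast hk
    have hang : 2 * Real.pi / L * a - 2 * Real.pi / L * b = ((-k : ℤ) : ℝ) * (2 * Real.pi) := by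
      rw [← mul_sub, show (a : ℝ) - b = -(L * k) by linarith]
      field_simp
      push_cast
      ring
    rw [hang, Real.cos_int_mul_two_pi, sub_self, abs_zero]
    linarith
  · rw [ZMod.natCast_eq_natCast_iff] at h
    obtain ⟨k, hk⟩ := Nat.modEq_iff_dvd.1 h
    have hk' : ((a : ℝ) + 1) - b = L * k := by exact_mod_cast hk
    have hang : 2 * Real.pi / L * a - 2 * Real.pi / L * b = (k : ℝ) * (2 * Real.pi) - 2 * Real.pi / L := by
      rw [← mul_sub, show (a : ℝ) - b = L * k - 1 by linarith]
      field_simp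
    rw [hang, Real.cos_int_mul_two_pi_sub, abs_sub_comm, abs_of_nonneg (by linarith)]
  · rw [ZMod.natCast_eq_natCast_iff] at h
    obtain ⟨k, hk⟩ := Nat.modEq_iff_dvd.1 h
    have hk' : ((b : ℝ) + 1) - a = L * k := by exact_mod_cast hk
    have hang : 2 * Real.pi / L * a - 2 * Real.pi / L * b = 2 * Real.pi / L - (k : ℝ) * (2 * Real.pi) := by
      rw [← mul_sub, show (a : ℝ) - b = 1 - L * k by linarith]
      field_simp
    rw [hang, Real.cos_sub_int_mul_two_pi, abs_sub_comm, abs_of_nonneg (by linarith)]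

variable [NeZero L]

/-- Every site of the torus `ℤ_L^d` has at most `2d` neighbours (`x ± e_i`). [folklore] -/
theorem card_filter_fermionTorusGraph_adj_le (u : FermionTorus d L) :
    (Finset.univ.filter fun v => (fermionTorusGraph d L).Adj u v).card ≤ 2 * d := by
  classical
  set S₁ : Finset (FermionTorus d L) := Finset.univ.image fun i : Fin d =>
    FermionTorus.ofTorusSite (FermionTorus.toTorusSite u + Pi.single i (1 : ZMod L))
  set S₂ : Finset (FermionTorus d L) := Finset.univ.image fun i : Fin d =>
    FermionTorus.ofTorusSite (FermionTorus.toTorusSite u - Pi.single i (1 : ZMod L))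
  have hsub : (Finset.univ.filter fun v => (fermionTorusGraph d L).Adj u v) ⊆ S₁ ∪ S₂ := by
    intro v hv
    rw [Finset.mem_filter] at hv
    obtain ⟨-, hv⟩ := hv
    rw [fermionTorusGraph_adj, torusGraph_adj_iff] at hv
    obtain ⟨-, ⟨i, hi⟩ | ⟨i, hi⟩⟩ := hv
    · refine Finset.mem_union_left _ (Finset.mem_image.2 ⟨i, Finset.mem_univ _, ?_⟩)
      rw [← hi, FermionTorus.ofTorusSite_toTorusSite]
    · refine Finset.mem_union_right _ (Finset.mem_image.2 ⟨i, Finset.mem_univ _, ?_⟩)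
      rw [hi, add_sub_cancel_right, FermionTorus.ofTorusSite_toTorusSite]
  calc (Finset.univ.filter fun v => (fermionTorusGraph d L).Adj u v).card
      ≤ (S₁ ∪ S₂).card := Finset.card_le_card hsub
    _ ≤ S₁.card + S₂.card := Finset.card_union_le _ _
    _ ≤ d + d := add_le_add (Finset.card_image_le.trans (by simp)) (Finset.card_image_le.trans (by simp))
    _ = 2 * d := by ring

omit [NeZero L] in
/-- The fermionic torus has `L^d` sites (private copy of `card_fermionTorus` of
`HubbardHubbardModelEtaPairingProofs`, not imported here). [folklore] -/
private theorem card_fermionTorus' : Fintype.card (FermionTorus d L) = L ^ d := by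
  change Fintype.card (Fin d → Fin L) = L ^ d
  rw [Fintype.card_fun, Fintype.card_fin, Fintype.card_fin]

/-- Summing a nonnegative constant over the ordered adjacent pairs of the torus:
`Σ_{u ∼ v} c ≤ L^d · 2d · c`. [folklore] -/
theorem sum_sum_adj_const_le {c : ℝ} (hc : 0 ≤ c) :
    (∑ u : FermionTorus d L, ∑ v : FermionTorus d L,
      if (fermionTorusGraph d L).Adj u v then c else 0) ≤ (L : ℝ) ^ d * (2 * d) * c := by
  classical
  have hrow : ∀ u : FermionTorus d L,
      (∑ v : FermionTorus d L, if (fermionTorusGraph d L).Adj u v then c else 0) ≤ 2 * d * c := by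
    intro u
    rw [← Finset.sum_filter, Finset.sum_const, nsmul_eq_mul]
    exact mul_le_mul_of_nonneg_right (by exact_mod_cast card_filter_fermionTorusGraph_adj_le u) hc
  calc (∑ u : FermionTorus d L, ∑ v : FermionTorus d L,
        if (fermionTorusGraph d L).Adj u v then c else 0)
      ≤ ∑ _u : FermionTorus d L, 2 * d * c := Finset.sum_le_sum fun u _ => hrow u
    _ = (L : ℝ) ^ d * (2 * d) * c := by
        rw [Finset.sum_const, nsmul_eq_mul, Finset.card_univ, card_fermionTorus']
        push_cast
        ring

end TorusGeometry

/-! ### The Lieb–Schultz–Mattis bound for the Hubbard model on the torus `ℤ_L^d` -/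

section LSMBound

variable {d L : ℕ} [NeZero L]

/-- **Energy cost of the Lieb–Schultz–Mattis twist for the Hubbard torus.** For the twist
`U_σ = exp[2πi L⁻¹ Σ_x x_{i₀} n_{xσ}]`, the perturbation `P_θ` by which the average energy of
`U_σ ψ`, `U_σ⁻¹ ψ` exceeds that of `ψ` satisfies `re ⟨φ, P_θ φ⟩ ≤ 8π² d |t| L^{d-2} ⟨φ, φ⟩`
(each of the `≤ 2d L^d` ordered bonds costs at most `|t| (1 - cos(2π/L)) ≤ 2π²|t|/L²` per spin).
Lieb–Schultz–Mattis, Ann. Phys. 16 (1961) 407, App. B; Yamanaka–Oshikawa–Affleck, PRL 79 (1997)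
1110. [folklore] -/
theorem re_expect_lsmPerturbation_lsmTwist_le (i₀ : Fin d) (σ : Fin 2) (t : ℝ)
    (φ : Fock (Orb (FermionTorus d L))) :
    (star φ ⬝ᵥ lsmPerturbation (fermionTorusGraph d L) (lsmTwist L i₀ σ) t *ᵥ φ).re ≤
      8 * Real.pi ^ 2 * d * |t| * (L : ℝ) ^ d / (L : ℝ) ^ 2 * (star φ ⬝ᵥ φ).re := by
  have hL : L ≠ 0 := NeZero.ne L
  have hL' : (L : ℝ) ≠ 0 := by exact_mod_cast hL
  have hnn : 0 ≤ (star φ ⬝ᵥ φ).re := by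
    rw [Matrix.star_dotProduct_self_re]; positivity
  refine (re_expect_lsmPerturbation_le (fermionTorusGraph d L) (lsmTwist L i₀ σ) t φ).trans
    (mul_le_mul_of_nonneg_right ?_ hnn)
  -- termwise bound on a bond
  have hbond : ∀ u v : FermionTorus d L, (fermionTorusGraph d L).Adj u v →
      (∑ τ : Fin 2, |Real.cos (lsmTwist L i₀ σ (orb u τ) - lsmTwist L i₀ σ (orb v τ)) - 1|) ≤
        2 * (1 - Real.cos (2 * Real.pi / L)) := by
    intro u v huv
    have hτ : ∀ τ : Fin 2, |Real.cos (lsmTwist L i₀ σ (orb u τ) - lsmTwist L i₀ σ (orb v τ)) - 1| ≤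
        1 - Real.cos (2 * Real.pi / L) := by
      intro τ
      simp only [lsmTwist_apply]
      change |Real.cos ((if τ = σ then 2 * Real.pi / L * ((ofLex u i₀ : ℕ) : ℝ) else 0) -
        (if τ = σ then 2 * Real.pi / L * ((ofLex v i₀ : ℕ) : ℝ) else 0)) - 1| ≤ 1 - Real.cos (2 * Real.pi / L)
      split_ifs
      · exact abs_cos_sub_one_le_of_rel hL (coord_rel_of_adj i₀ huv)
      · rw [sub_zero, Real.cos_zero, sub_self, abs_zero]
        linarith [Real.cos_le_one (2 * Real.pi / L)]
    calc (∑ τ : Fin 2, |Real.cos (lsmTwist L i₀ σ (orb u τ) - lsmTwist L i₀ σ (orb v τ)) - 1|)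
        ≤ ∑ _τ : Fin 2, (1 - Real.cos (2 * Real.pi / L)) := Finset.sum_le_sum fun τ _ => hτ τ
      _ = 2 * (1 - Real.cos (2 * Real.pi / L)) := by rw [Fin.sum_univ_two]; ring
  -- the bond sum
  have hc : 0 ≤ 2 * (1 - Real.cos (2 * Real.pi / L)) := by linarith [Real.cos_le_one (2 * Real.pi / L)]
  have hsum : (∑ u : FermionTorus d L, ∑ v : FermionTorus d L,
      if (fermionTorusGraph d L).Adj u v then
        ∑ τ : Fin 2, |Real.cos (lsmTwist L i₀ σ (orb u τ) - lsmTwist L i₀ σ (orb v τ)) - 1| else 0) ≤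
      (L : ℝ) ^ d * (2 * d) * (2 * (1 - Real.cos (2 * Real.pi / L))) := by
    refine le_trans ?_ (sum_sum_adj_const_le hc)
    refine Finset.sum_le_sum fun u _ => Finset.sum_le_sum fun v _ => ?_
    split_ifs with huv
    · exact hbond u v huv
    · exact le_rfl
  -- `1 - cos x ≤ x² / 2`
  have hcos : 2 * (1 - Real.cos (2 * Real.pi / L)) ≤ 4 * Real.pi ^ 2 / (L : ℝ) ^ 2 := by
    have h := Real.one_sub_sq_div_two_le_cos (x := 2 * Real.pi / L)
    have : (2 * Real.pi / L) ^ 2 = 4 * Real.pi ^ 2 / (L : ℝ) ^ 2 := by ring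
    linarith
  calc |t| * (∑ u : FermionTorus d L, ∑ v : FermionTorus d L,
        if (fermionTorusGraph d L).Adj u v then
          ∑ τ : Fin 2, |Real.cos (lsmTwist L i₀ σ (orb u τ) - lsmTwist L i₀ σ (orb v τ)) - 1| else 0)
      ≤ |t| * ((L : ℝ) ^ d * (2 * d) * (2 * (1 - Real.cos (2 * Real.pi / L)))) :=
        mul_le_mul_of_nonneg_left hsum (abs_nonneg t)
    _ ≤ |t| * ((L : ℝ) ^ d * (2 * d) * (4 * Real.pi ^ 2 / (L : ℝ) ^ 2)) :=
        mul_le_mul_of_nonneg_left (mul_le_mul_of_nonneg_left hcos (by positivity)) (abs_nonneg t)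
    _ = 8 * Real.pi ^ 2 * d * |t| * (L : ℝ) ^ d / (L : ℝ) ^ 2 := by ring

/-- **The Lieb–Schultz–Mattis bound for the Hubbard model on the torus `ℤ_L^d`.** If the
grand-canonical Hubbard Hamiltonian `H(t,U) - μN` on `ℤ_L^d` has a unique ground state `ψ` with
spectral gap `g` on the Fock space, and `ψ` carries `m` particles of spin `σ` with `L ∤ m`, then
`g ≤ 8π² d |t| L^{d-2}`: the ground state is an eigenvector of the unit translation `T`
(uniqueness), the twist `U = exp[2πi L⁻¹ Σ_x x_{i₀} n_{xσ}]` satisfies `U T ψ = e^{2πi m/L} T U ψ`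
so `⟨ψ, U^{±1} ψ⟩ = 0`, and the gap is at most the average energy increase of `U^{±1}ψ`. For
`d = 1` this is the Lieb–Schultz–Mattis / Yamanaka–Oshikawa–Affleck theorem for the Hubbard
chain; for `d ≥ 2` the bound does not decay with `L` (the known limitation of the variational
twist). Lieb–Schultz–Mattis, Ann. Phys. 16 (1961) 407, App. B; Yamanaka–Oshikawa–Affleck,
PRL 79 (1997) 1110; Tasaki, J. Stat. Phys. 170 (2018) 653, §2.2 Theorem 0 and §4.2.
[cite: Tasaki2018, §2.2 Theorem 0 (global twist) and §4.2 (lattice electrons / Hubbard model)] -/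
theorem hubbardTorusWith_gap_le_of_not_dvd (i₀ : Fin d) {t U μ g : ℝ}
    (hgap : (hubbardTorusWith d L t U μ).HasSpectralGap g)
    {ψ : Fock (Orb (FermionTorus d L))} (hψ : (hubbardTorusWith d L t U μ).IsGroundStateVector ψ)
    (σ : Fin 2) {m : ℕ} (hm : ∀ s, ψ s ≠ 0 → spinCount σ s = m) (hdvd : ¬ L ∣ m) :
    g ≤ 8 * Real.pi ^ 2 * d * |t| * (L : ℝ) ^ d / (L : ℝ) ^ 2 := by
  -- the ground state is an eigenvector of the translation
  obtain ⟨lam, hlam⟩ := hgap.exists_mulVec_eq_smul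
    (relabelOp_lsmShift_mul_hubbardTorusWith (L := L) i₀ t U μ) hψ
  -- twisted commutation of twist and translation on the `N_σ = m` sector
  have hc : fockTwist (lsmTwist L i₀ σ) *ᵥ (relabelOp (lsmShift (L := L) i₀) *ᵥ ψ) =
      cexp (2 * Real.pi * I * m / L) •
        (relabelOp (lsmShift (L := L) i₀) *ᵥ (fockTwist (lsmTwist L i₀ σ) *ᵥ ψ)) :=
    fockTwist_mulVec_relabelOp_mulVec fun s hs => cexp_sum_lsmTwist_lsmShift i₀ σ (hm s hs)
  -- the twisted ground states are orthogonal to the ground state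
  have h1 : star ψ ⬝ᵥ fockTwist (lsmTwist L i₀ σ) *ᵥ ψ = 0 :=
    Matrix.star_dotProduct_mulVec_eq_zero_of_twisted_commute
      (conjTranspose_relabelOp_mulVec_mulVec _) hψ.1 hlam hc (cexp_two_pi_mul_div_ne_one hdvd)
  have h2 : star ψ ⬝ᵥ (fockTwist (lsmTwist L i₀ σ))ᴴ *ᵥ ψ = 0 := by
    rw [Matrix.star_dotProduct_conjTranspose_mulVec_eq_star, h1, star_zero]
  -- the two twisted Hamiltonians
  have hP : (fockTwist (lsmTwist L i₀ σ))ᴴ * hubbardTorusWith d L t U μ * fockTwist (lsmTwist L i₀ σ) +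
      fockTwist (lsmTwist L i₀ σ) * hubbardTorusWith d L t U μ * (fockTwist (lsmTwist L i₀ σ))ᴴ =
      (2 : ℂ) • hubbardTorusWith d L t U μ +
        (2 : ℂ) • lsmPerturbation (fermionTorusGraph d L) (lsmTwist L i₀ σ) t := by
    rw [conjTranspose_fockTwist, add_comm]
    exact fockTwist_conj_hamiltonianWith_add (fermionTorusGraph d L) (lsmTwist L i₀ σ) t U μ
  exact hgap.gap_le_of_twist hψ (conjTranspose_fockTwist_mulVec_mulVec _)
    (fockTwist_mulVec_conjTranspose_mulVec _) h1 h2 hP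
    (re_expect_lsmPerturbation_lsmTwist_le i₀ σ t)

/-- The spin-resolved particle numbers of a nonzero vector of a joint sector `szSector N M` are
constant on its support: `N_σ(s) = N_σ(s₀)`. [folklore] -/
theorem spinCount_eq_spinCount_of_mem_szSector {Λ : Type*} [LinearOrder Λ] [Fintype Λ] {N : ℕ}
    {M : ℝ} {ψ : Fock (Orb Λ)} (h : ψ ∈ szSector N M) {s s₀ : Finset (Orb Λ)} (hs : ψ s ≠ 0)
    (hs₀ : ψ s₀ ≠ 0) (σ : Fin 2) : spinCount σ s = spinCount σ s₀ := by
  have h1 := spinCount_eq_of_mem_szSector h hs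
  have h0 := spinCount_eq_of_mem_szSector h hs₀
  have : (spinCount σ s : ℝ) = spinCount σ s₀ := by
    fin_cases σ
    · exact h1.1.trans h0.1.symm
    · exact h1.2.trans h0.2.symm
  exact_mod_cast this

/-- **Filling dichotomy for unique gapped ground states of the Hubbard torus.** Under the
hypotheses of `hubbardTorusWith_gap_le_of_not_dvd`, for a ground state in the sector
`szSector N M` and either spin species: either `L` divides the number `N_σ` of spin-`σ` particles
(so the filling per transverse layer `N_σ / L` is an integer), or `g ≤ 8π² d |t| L^{d-2}`.
Lieb–Schultz–Mattis (1961), App. B; Yamanaka–Oshikawa–Affleck (1997); Tasaki (2018) §2.2 Thm. 0.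
[cite: Tasaki2018, §2.2 Theorem 0 and §4.2] -/
theorem hubbardTorusWith_dvd_spinCount_or_gap_le (i₀ : Fin d) {t U μ g : ℝ}
    (hgap : (hubbardTorusWith d L t U μ).HasSpectralGap g)
    {ψ : Fock (Orb (FermionTorus d L))} (hψ : (hubbardTorusWith d L t U μ).IsGroundStateVector ψ)
    {N : ℕ} {M : ℝ} (hmem : ψ ∈ szSector N M) {s₀ : Finset (Orb (FermionTorus d L))}
    (hs₀ : ψ s₀ ≠ 0) (σ : Fin 2) :
    L ∣ spinCount σ s₀ ∨ g ≤ 8 * Real.pi ^ 2 * d * |t| * (L : ℝ) ^ d / (L : ℝ) ^ 2 := by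
  by_cases hdvd : L ∣ spinCount σ s₀
  · exact Or.inl hdvd
  · exact Or.inr (hubbardTorusWith_gap_le_of_not_dvd i₀ hgap hψ σ
      (fun s hs => spinCount_eq_spinCount_of_mem_szSector hmem hs hs₀ σ) hdvd)

/-- Elementary bookkeeping: if `L ∤ m` forces `L ≤ B` (with `B ≥ 0`), then `m / L` is within
`(B + 1)^k / L^k` of an integer. [folklore] -/
theorem exists_int_abs_div_sub_le {L k : ℕ} (hL : 0 < L) {B : ℝ} (hB : 0 ≤ B) (m : ℕ)
    (h : ¬ L ∣ m → (L : ℝ) ≤ B) :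
    ∃ n : ℤ, |(m : ℝ) / L - n| ≤ (B + 1) ^ k / (L : ℝ) ^ k := by
  have hL' : (0 : ℝ) < L := by exact_mod_cast hL
  by_cases hdvd : L ∣ m
  · refine ⟨((m / L : ℕ) : ℤ), ?_⟩
    rw [Int.cast_natCast, Nat.cast_div hdvd hL'.ne', sub_self, abs_zero]
    positivity
  · refine ⟨⌊(m : ℝ) / L⌋, ?_⟩
    have hLB : (L : ℝ) ≤ B + 1 := (h hdvd).trans (by linarith)
    rw [Int.self_sub_floor, abs_of_nonneg (Int.fract_nonneg _)]
    refine (Int.fract_lt_one _).le.trans ?_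
    rw [le_div_iff₀ (by positivity), one_mul]
    exact pow_le_pow_left₀ hL'.le hLB k

/-- **The Lieb–Schultz–Mattis–Oshikawa filling constraint for the Hubbard chain (`d = 1`).**
The conclusion of `bbdf2019_lsm_filling_hubbardTorus` in dimension one, PROVED by the
Lieb–Schultz–Mattis twist: along any sequence of rings `ℤ_{L_j}` (`L_j ≥ 2`) on which
`H(t,U) - μN` has a unique ground state with a uniform spectral gap `g > 0`, the spin-resolved
fillings `N_↑/L_j`, `N_↓/L_j` of the ground state are within `C L_j^{-k}` of integers — indeed
exactly integers as soon as `L_j > 8π²|t|/g` (`hubbardTorusWith_dvd_spinCount_or_gap_le`).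
Lieb–Schultz–Mattis, Ann. Phys. 16 (1961) 407, App. B; Yamanaka–Oshikawa–Affleck, PRL 79 (1997)
1110 (Hubbard chain); Tasaki, J. Stat. Phys. 170 (2018) 653, §2.2 Theorem 0 and §4.2; cf.
Bachmann–Bols–De Roeck–Fraas, CMP 375 (2019) 1249, §3.2 (the statement for all `d`).
[cite: Tasaki2018, §2.2 Theorem 0 and §4.2; LiebSchultzMattisAP1961, App. B Thm. 2] -/
theorem lsm_filling_hubbardTorus_dim_one (t U μ g : ℝ) (L : ℕ → ℕ) (hg : 0 < g)
    (hL : ∀ j, Even (L j) ∧ 2 ≤ L j)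
    (hgap : ∀ j, (hubbardTorusWith 1 (L j) t U μ).HasSpectralGap g) (k : ℕ) :
    ∃ C : ℝ, ∀ (j : ℕ) (N : ℕ) (M : ℝ) (ψ : Fock (Orb (FermionTorus 1 (L j)))),
      (hubbardTorusWith 1 (L j) t U μ).IsGroundStateVector ψ → ψ ∈ szSector N M →
        (∃ n : ℤ, |((N : ℝ) / 2 + M) / L j - n| ≤ C / (L j : ℝ) ^ k) ∧
        (∃ n : ℤ, |((N : ℝ) / 2 - M) / L j - n| ≤ C / (L j : ℝ) ^ k) := by
  set B : ℝ := 8 * Real.pi ^ 2 * |t| / g with hB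
  have hB0 : 0 ≤ B := by positivity
  refine ⟨(B + 1) ^ k, fun j N M ψ hψ hmem => ?_⟩
  have hLj : 0 < L j := by have := (hL j).2; omega
  haveI : NeZero (L j) := ⟨hLj.ne'⟩
  have hLj' : (0 : ℝ) < L j := by exact_mod_cast hLj
  obtain ⟨s₀, hs₀⟩ := Function.ne_iff.1 hψ.1
  have hsc := spinCount_eq_of_mem_szSector hmem hs₀
  -- if `L ∤ N_σ` then `L ≤ B`
  have key : ∀ σ : Fin 2, ¬ L j ∣ spinCount σ s₀ → (L j : ℝ) ≤ B := by
    intro σ hdvd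
    rcases hubbardTorusWith_dvd_spinCount_or_gap_le (0 : Fin 1) (hgap j) hψ hmem hs₀ σ with h | h
    · exact absurd h hdvd
    · -- `g ≤ 8π²|t| L / L²`, i.e. `L ≤ 8π²|t|/g`
      have h1 : g ≤ 8 * Real.pi ^ 2 * |t| * (L j : ℝ) / (L j : ℝ) ^ 2 := by
        simpa only [Nat.cast_one, mul_one, pow_one] using h
      rw [le_div_iff₀ (by positivity)] at h1
      rw [hB, le_div_iff₀ hg]
      nlinarith
  constructor
  · rw [← hsc.1]
    exact exists_int_abs_div_sub_le hLj hB0 _ (key 0)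
  · rw [← hsc.2]
    exact exists_int_abs_div_sub_le hLj hB0 _ (key 1)

end LSMBound

end Literature.MathematicalPhysics.QuantumLattice

end
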